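import Mathlib
import Literature.Probability.LatticeModels.ScalingLimit
import HarnessLib

/-!
# Monopole lower bound for positive Riesz potentials on `ℝ³`

Stub `stub_monopoleLowerBound` of line `Sketch` (card `amputated-lebowitz-vertex-measure`) of crux
stmt-CriticalPhenomena-4801 `PrecisionLaplacian.MoebiusLimitOfTwoPointLaw`.

Elementary potential theory, pure Mathlib measure theory (nothing Ising-specific): if `ν ≠ 0` is a finite
positive measure on `ℝ³`, `0 < Δ`, `0 < c`, and the Riesz potential `p(x) = ∫ c‖x − z‖^{-2Δ} dν(z)` is a
convergent (Bochner) integral for all `x` outside a compact set, then `‖x‖^{2Δ} p(x)` does NOT tend to `0`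
along the cocompact filter.

Proof. A non-zero measure charges some ball `B_R = closedBall 0 R` (`R : ℕ`) with mass `m > 0`. For
`R + 1 ≤ ‖x‖` and `z ∈ B_R` one has `0 < ‖x − z‖ ≤ ‖x‖ + R ≤ 2‖x‖`, hence
`p(x) ≥ ∫_{B_R} c‖x − z‖^{-2Δ} dν ≥ c m (‖x‖ + R)^{-2Δ} ≥ c m 2^{-2Δ} ‖x‖^{-2Δ}`, i.e.
`‖x‖^{2Δ} p(x) ≥ c m 2^{-2Δ} > 0`. Along the (non-trivial) cocompact filter the three eventualities
"integrable", "`‖x‖^{2Δ} p(x) < c m 2^{-2Δ}`" (from the assumed limit `0`) and "`R + 1 ≤ ‖x‖`" would hold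
simultaneously at some point `x` — a contradiction.
-/

noncomputable section

namespace Summit.CriticalPhenomena.Ising3DConformalLimit.PrecisionLaplacianMoebiusLimitOfTwoPointLaw

open Literature.Probability.LatticeModels Filter Topology EuclideanGeometry MeasureTheory

/-- A non-zero measure on `ℝ³` charges some closed ball around the origin of natural radius. -/
theorem exists_closedBall_measure_pos (ν : Measure (EuclideanSpace ℝ (Fin 3))) (hν : ν ≠ 0) :
    ∃ R : ℕ, 0 < ν (Metric.closedBall (0 : EuclideanSpace ℝ (Fin 3)) R) := by
  have huniv : ν Set.univ ≠ 0 := by rwa [Ne, Measure.measure_univ_eq_zero]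
  by_contra hcon
  push Not at hcon
  have h0 : ∀ n : ℕ, ν (Metric.closedBall (0 : EuclideanSpace ℝ (Fin 3)) n) = 0 := fun n =>
    nonpos_iff_eq_zero.1 (hcon n)
  have hU : (Set.univ : Set (EuclideanSpace ℝ (Fin 3))) =
      ⋃ n : ℕ, Metric.closedBall (0 : EuclideanSpace ℝ (Fin 3)) n := by
    ext z
    simp only [Set.mem_univ, Set.mem_iUnion, Metric.mem_closedBall, dist_zero_right, true_iff]
    exact exists_nat_ge ‖z‖
  exact huniv (by rw [hU]; exact measure_iUnion_null h0)

/-- **Set-integral lower bound for the potential.** If `R + 1 ≤ ‖x‖` and the kernel `z ↦ c‖x − z‖^{-2Δ}`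
(`0 < c`, `0 < Δ`) is `ν`-integrable, then `ν(B_R) · c (‖x‖ + R)^{-2Δ} ≤ ∫ c‖x − z‖^{-2Δ} dν(z)`:
restrict to the ball `B_R = closedBall 0 R`, where `0 < ‖x − z‖ ≤ ‖x‖ + R`. -/
theorem measure_closedBall_mul_le_potential {Δ c : ℝ} (hΔ : 0 < Δ) (hc : 0 < c)
    (ν : Measure (EuclideanSpace ℝ (Fin 3))) [IsFiniteMeasure ν] (R : ℕ) (x : EuclideanSpace ℝ (Fin 3))
    (hx : (R : ℝ) + 1 ≤ ‖x‖) (hint : Integrable (fun z => c * ‖x - z‖ ^ (-(2 * Δ))) ν) :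
    (ν (Metric.closedBall (0 : EuclideanSpace ℝ (Fin 3)) R)).toReal * (c * (‖x‖ + R) ^ (-(2 * Δ))) ≤
      ∫ z, c * ‖x - z‖ ^ (-(2 * Δ)) ∂ν := by
  have hball : ∀ z ∈ Metric.closedBall (0 : EuclideanSpace ℝ (Fin 3)) R,
      c * (‖x‖ + R) ^ (-(2 * Δ)) ≤ c * ‖x - z‖ ^ (-(2 * Δ)) := by
    intro z hz
    rw [Metric.mem_closedBall, dist_zero_right] at hz
    have hpos : 0 < ‖x - z‖ := by
      have h1 := norm_sub_norm_le x z
      linarith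
    have hle : ‖x - z‖ ≤ ‖x‖ + R := by
      calc ‖x - z‖ ≤ ‖x‖ + ‖z‖ := norm_sub_le _ _
        _ ≤ ‖x‖ + R := by linarith
    exact mul_le_mul_of_nonneg_left (Real.rpow_le_rpow_of_nonpos hpos hle (by linarith)) hc.le
  have hconst : IntegrableOn (fun _ : EuclideanSpace ℝ (Fin 3) => c * (‖x‖ + R) ^ (-(2 * Δ)))
      (Metric.closedBall (0 : EuclideanSpace ℝ (Fin 3)) R) ν :=
    integrableOn_const
  have hstep : (ν (Metric.closedBall (0 : EuclideanSpace ℝ (Fin 3)) R)).toReal * (c * (‖x‖ + R) ^ (-(2 * Δ))) =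
      ∫ _ in Metric.closedBall (0 : EuclideanSpace ℝ (Fin 3)) R, c * (‖x‖ + R) ^ (-(2 * Δ)) ∂ν := by
    rw [setIntegral_const, smul_eq_mul, measureReal_def]
  rw [hstep]
  calc ∫ _ in Metric.closedBall (0 : EuclideanSpace ℝ (Fin 3)) R, c * (‖x‖ + R) ^ (-(2 * Δ)) ∂ν
      ≤ ∫ z in Metric.closedBall (0 : EuclideanSpace ℝ (Fin 3)) R, c * ‖x - z‖ ^ (-(2 * Δ)) ∂ν :=
        setIntegral_mono_on hconst hint.integrableOn measurableSet_closedBall hball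
    _ ≤ ∫ z, c * ‖x - z‖ ^ (-(2 * Δ)) ∂ν :=
        setIntegral_le_integral hint
          (Eventually.of_forall fun z => mul_nonneg hc.le (Real.rpow_nonneg (norm_nonneg _) _))

/-- **Monopole lower bound for positive Riesz potentials (tooth of line `Sketch`).** If `ν ≠ 0` is a
finite positive measure on `ℝ³`, `0 < Δ`, `0 < c`, and the potential `∫ c‖x − z‖^{-2Δ} dν(z)` is a genuine
(convergent) integral for all `x` outside some compact set, then `‖x‖^{2Δ} ∫ c‖x − z‖^{-2Δ} dν(z)` does NOT
tend to `0` at infinity (it is eventually `≥ c 2^{-2Δ} ν(B_R) > 0` once `ν(B_R) > 0`). -/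
theorem stub_monopoleLowerBound :
    ∀ Δ c : ℝ, 0 < Δ → 0 < c →
      ∀ ν : Measure (EuclideanSpace ℝ (Fin 3)), IsFiniteMeasure ν → ν ≠ 0 →
        (∀ᶠ x in cocompact (EuclideanSpace ℝ (Fin 3)),
          Integrable (fun z => c * ‖x - z‖ ^ (-(2 * Δ))) ν) →
        ¬ Tendsto (fun x : EuclideanSpace ℝ (Fin 3) => ‖x‖ ^ (2 * Δ) * ∫ z, c * ‖x - z‖ ^ (-(2 * Δ)) ∂ν)
            (cocompact (EuclideanSpace ℝ (Fin 3))) (nhds 0) := by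
  intro Δ c hΔ hc ν hfin hν hint hT
  -- a ball of positive mass `m`
  obtain ⟨R, hR⟩ := exists_closedBall_measure_pos ν hν
  have hmpos : 0 < (ν (Metric.closedBall (0 : EuclideanSpace ℝ (Fin 3)) R)).toReal :=
    ENNReal.toReal_pos hR.ne' (measure_ne_top ν _)
  have hRnn : (0 : ℝ) ≤ R := Nat.cast_nonneg R
  -- the positive floor `m c 2^{-2Δ}`
  have hLpos : 0 < (ν (Metric.closedBall (0 : EuclideanSpace ℝ (Fin 3)) R)).toReal *
      (c * (2 : ℝ) ^ (-(2 * Δ))) :=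
    mul_pos hmpos (mul_pos hc (Real.rpow_pos_of_pos (by norm_num) _))
  -- three eventualities along the cocompact filter
  have hlt : ∀ᶠ x in cocompact (EuclideanSpace ℝ (Fin 3)),
      ‖x‖ ^ (2 * Δ) * ∫ z, c * ‖x - z‖ ^ (-(2 * Δ)) ∂ν <
        (ν (Metric.closedBall (0 : EuclideanSpace ℝ (Fin 3)) R)).toReal * (c * (2 : ℝ) ^ (-(2 * Δ))) :=
    hT.eventually_lt_const hLpos
  have hfar : ∀ᶠ x in cocompact (EuclideanSpace ℝ (Fin 3)), (R : ℝ) + 1 ≤ ‖x‖ := by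
    filter_upwards [(isCompact_closedBall (0 : EuclideanSpace ℝ (Fin 3)) ((R : ℝ) + 1)).compl_mem_cocompact]
      with x hx
    rw [Set.mem_compl_iff, Metric.mem_closedBall, dist_zero_right, not_le] at hx
    exact hx.le
  obtain ⟨x, hix, hxlt, hxfar⟩ := (hint.and (hlt.and hfar)).exists
  -- the lower bound at the point `x`
  have hlow := measure_closedBall_mul_le_potential hΔ hc ν R x hxfar hix
  have htpos : 0 < ‖x‖ := by linarith
  -- `(‖x‖ + R)^{-2Δ} ≥ (2‖x‖)^{-2Δ} = 2^{-2Δ} ‖x‖^{-2Δ}`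
  have hA : (2 * ‖x‖) ^ (-(2 * Δ)) ≤ (‖x‖ + R) ^ (-(2 * Δ)) :=
    Real.rpow_le_rpow_of_nonpos (by linarith) (by linarith) (by linarith)
  have hA' : (2 * ‖x‖) ^ (-(2 * Δ)) = (2 : ℝ) ^ (-(2 * Δ)) * ‖x‖ ^ (-(2 * Δ)) :=
    Real.mul_rpow (by norm_num) htpos.le
  have hcancel : ‖x‖ ^ (2 * Δ) * ‖x‖ ^ (-(2 * Δ)) = 1 := by
    rw [Real.rpow_neg htpos.le, mul_inv_cancel₀ (Real.rpow_pos_of_pos htpos _).ne']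
  have hxpow : 0 ≤ ‖x‖ ^ (2 * Δ) := Real.rpow_nonneg htpos.le _
  have hge : (ν (Metric.closedBall (0 : EuclideanSpace ℝ (Fin 3)) R)).toReal * (c * (2 : ℝ) ^ (-(2 * Δ))) ≤
      ‖x‖ ^ (2 * Δ) * ∫ z, c * ‖x - z‖ ^ (-(2 * Δ)) ∂ν :=
    calc (ν (Metric.closedBall (0 : EuclideanSpace ℝ (Fin 3)) R)).toReal * (c * (2 : ℝ) ^ (-(2 * Δ)))
        = (ν (Metric.closedBall (0 : EuclideanSpace ℝ (Fin 3)) R)).toReal * (c * (2 : ℝ) ^ (-(2 * Δ))) *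
            (‖x‖ ^ (2 * Δ) * ‖x‖ ^ (-(2 * Δ))) := by rw [hcancel, mul_one]
      _ = ‖x‖ ^ (2 * Δ) * ((ν (Metric.closedBall (0 : EuclideanSpace ℝ (Fin 3)) R)).toReal *
            (c * ((2 : ℝ) ^ (-(2 * Δ)) * ‖x‖ ^ (-(2 * Δ))))) := by ring
      _ = ‖x‖ ^ (2 * Δ) * ((ν (Metric.closedBall (0 : EuclideanSpace ℝ (Fin 3)) R)).toReal *
            (c * (2 * ‖x‖) ^ (-(2 * Δ)))) := by rw [hA']
      _ ≤ ‖x‖ ^ (2 * Δ) * ((ν (Metric.closedBall (0 : EuclideanSpace ℝ (Fin 3)) R)).toReal *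
            (c * (‖x‖ + R) ^ (-(2 * Δ)))) := by gcongr
      _ ≤ ‖x‖ ^ (2 * Δ) * ∫ z, c * ‖x - z‖ ^ (-(2 * Δ)) ∂ν := mul_le_mul_of_nonneg_left hlow hxpow
  exact absurd hxlt (not_lt.2 hge)

end Summit.CriticalPhenomena.Ising3DConformalLimit.PrecisionLaplacianMoebiusLimitOfTwoPointLaw

end
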